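import Mathlib
import HarnessLib
import Literature.RepresentationTheory.CompactGroups.WeylIntegralFormula
import Summits.Ventures.LatticeQCDFlow.Exactness.SU3SpectralCouplingLayerUnconditional
import Summits.Ventures.LatticeQCDFlow.Exactness.SU3TorusBookedDensity
import Summits.Ventures.LatticeQCDFlow.Exactness.SpectralTorusBasics
import Summits.Ventures.LatticeQCDFlow.Exactness.SpectralDensityMeasurable
import Summits.Ventures.LatticeQCDFlow.Exactness.SpectralKernelMeasurableRecipe
import Summits.Ventures.LatticeQCDFlow.Exactness.SpectralTorusMapMeasurable

/-!
# The `SU(3)` spectral kernel and spectral coupling layer with the densities the engine books are exact transports of (product) Haar — the bookkeeping hypotheses eliminated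

HONEST FRAMING: exact (Metropolis-corrected) sampling algorithms for lattice gauge theory;
figures of merit are autocorrelation/cost numbers at stated couplings and volumes; no
continuum-physics claim.

Venture `LatticeQCDFlow` (cell pub-lqcd), topic `Exactness`; FANOUT row 10 (`eng-equiv`, engine
`latflow.equiv` `SUNSpectralCoupling` / `flows_jax.sun_flow` `preset_boyda2021` `SU(3)`: per active
link the kernel books `ldj = ld_cell + log_haar(x') − log_haar(x)`, a symmetric function of the
eigen-phases; Boyda et al., PRD 103 (2021) 074504 §III–IV, App. B Algorithm 2).  NEW WORK of the cell:
corollaries of `SU3TorusBookedDensity.lean` (`exists_torusDensity_su3_booked`) and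
`SU3SpectralCouplingLayerUnconditional.lean`.  Nothing is cited as a fact; no number; no definition.

## What is typed (`A = {θ₀ < θ₁ < −θ₀−θ₁ < θ₀ + 2π}`, `x(θ) = (θ₀, θ₁, −θ₀−θ₁)`, `D(d) = |Δ(d)|²/3!`)

* **`hasJacobian_spectralKernel_su3_booked`** — `f` measurable (no continuity: the engine's `f` jumps across alcove walls),
  permutation-equivariant, given on the alcove by `G` (`G(A) ⊆ A`, `HasJacobian (Leb|_A) G JA`); ANY
  kernel `h` following the spectral recipe of `f`; ANY `J` (measurability is automatic, `measurable_of_spectral`) which is a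
  symmetric measurable function `JD` of the spectrum with `JD(e^{ix(θ)}) D(e^{ix(θ)}) = JA(θ) D(e^{ix(Gθ)})`
  on `A`:  `HasJacobian (Haar SU(3)) h J`;
* **`hasJacobian_spectralCouplingLayer_su3_booked`** — the same per active link and frozen context:
  the `SU(3)` spectral coupling layer `Theory2.coupleFun p (u ↦ h a y (uS)(uS)⁻¹u)` has
  `HasJacobian (⊗ Haar_{SU(3)}) _ (ofReal ∘ Theory2.coupleJac p (j at the loops))` with the BOOKED
  per-link densities `j a y` — nothing assumed beyond the architecture (continuity, equivariance,
  the cell flow's Jacobian on the alcove, and `j` = the booked symmetric function of the spectrum).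

NOT here: the elimination of the measurability of `J`; `N ≥ 4`; any number.
-/

noncomputable section

namespace Summit.Ventures.LatticeQCDFlow.Exactness

open MeasureTheory Matrix Set Real
open Literature.LinearAlgebra.Matrix
open Literature.MathematicalPhysics.QuantumFieldTheory (haarProbability)
open Literature.RepresentationTheory.CompactGroups
open scoped ENNReal

section SU3

variable {E : (Fin 2 → ℝ) → specialDiagonalTorus (Fin 3)}
  (hE : ∀ θ (i : Fin 3), (((E θ : specialDiagonalTorus (Fin 3)) : Matrix.specialUnitaryGroup (Fin 3) ℂ) :
    Matrix (Fin 3) (Fin 3) ℂ) i i = (Circle.exp ((![θ 0, θ 1, -(θ 0 + θ 1)] : Fin 3 → ℝ) i) : ℂ))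
  {P : Equiv.Perm (Fin 3) → specialDiagonalTorus (Fin 3) → specialDiagonalTorus (Fin 3)}
  (hP : ∀ σ t i,
    (((P σ t : specialDiagonalTorus (Fin 3)) : Matrix.specialUnitaryGroup (Fin 3) ℂ) : Matrix (Fin 3) (Fin 3) ℂ) i i =
      ((t : Matrix.specialUnitaryGroup (Fin 3) ℂ) : Matrix (Fin 3) (Fin 3) ℂ) (σ i) (σ i))

include hE hP

/-- **The `SU(3)` spectral kernel with the booked density is an exact transport of Haar.**  `f`
measurable (no continuity: the engine's `f` jumps across alcove walls), permutation-equivariant, given on the alcove `A` by a flow `G`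
mapping `A` into `A` with `HasJacobian (Leb|_A) G JA`; `h` ANY kernel following the spectral recipe
of `f` (`f` preserving unimodularity and unit product); `J` ANY density (measurable automatically) which is a symmetric
measurable function `JD` of the spectrum with the booked value on the alcove chart,
`JD(e^{ix(θ)}) · |Δ(e^{ix(θ)})|²/3! = JA(θ) · |Δ(e^{ix(Gθ)})|²/3!`.  Then `HasJacobian (Haar SU(3)) h J`. -/
theorem hasJacobian_spectralKernel_su3_booked
    {f : (Fin 3 → ℂ) → (Fin 3 → ℂ)} (hfm : Measurable f)
    (hfperm : ∀ (σ : Equiv.Perm (Fin 3)) (d : Fin 3 → ℂ), (∀ i, ‖d i‖ = 1) →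
      f (fun i => d (σ i)) = fun i => f d (σ i))
    {G : (Fin 2 → ℝ) → (Fin 2 → ℝ)} {JA : (Fin 2 → ℝ) → ℝ≥0∞}
    (hG : HasJacobian ((volume : Measure (Fin 2 → ℝ)).restrict
      {θ : Fin 2 → ℝ | θ 0 < θ 1 ∧ θ 1 < -(θ 0 + θ 1) ∧ -(θ 0 + θ 1) < θ 0 + 2 * π}) G JA)
    (hGA : ∀ θ : Fin 2 → ℝ, θ 0 < θ 1 → θ 1 < -(θ 0 + θ 1) → -(θ 0 + θ 1) < θ 0 + 2 * π →
      (G θ) 0 < (G θ) 1 ∧ (G θ) 1 < -((G θ) 0 + (G θ) 1) ∧ -((G θ) 0 + (G θ) 1) < (G θ) 0 + 2 * π)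
    (hfG : ∀ θ : Fin 2 → ℝ, θ 0 < θ 1 → θ 1 < -(θ 0 + θ 1) → -(θ 0 + θ 1) < θ 0 + 2 * π →
      f (fun i => (Circle.exp ((![θ 0, θ 1, -(θ 0 + θ 1)] : Fin 3 → ℝ) i) : ℂ)) =
        fun i => (Circle.exp ((![(G θ) 0, (G θ) 1, -((G θ) 0 + (G θ) 1)] : Fin 3 → ℝ) i) : ℂ))
    {h : Matrix.specialUnitaryGroup (Fin 3) ℂ → Matrix.specialUnitaryGroup (Fin 3) ℂ}
    (hagree : ∀ (Q : Matrix.specialUnitaryGroup (Fin 3) ℂ) (V : Matrix (Fin 3) (Fin 3) ℂ) (d : Fin 3 → ℂ),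
      V ∈ Matrix.unitaryGroup (Fin 3) ℂ → (Q : Matrix (Fin 3) (Fin 3) ℂ) = V * diagonal d * star V →
        ((h Q : Matrix.specialUnitaryGroup (Fin 3) ℂ) : Matrix (Fin 3) (Fin 3) ℂ) = V * diagonal (f d) * star V)
    (hf1 : ∀ d : Fin 3 → ℂ, (∀ i, ‖d i‖ = 1) → ∀ i, ‖f d i‖ = 1)
    (hfdet : ∀ d : Fin 3 → ℂ, (∀ i, ‖d i‖ = 1) → ∏ i, d i = 1 → ∏ i, f d i = 1)
    {JD : (Fin 3 → ℂ) → ℝ≥0∞} (hJDm : Measurable JD)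
    (hJDperm : ∀ (σ : Equiv.Perm (Fin 3)) (d : Fin 3 → ℂ), JD (fun i => d (σ i)) = JD d)
    (hJchart : ∀ θ : Fin 2 → ℝ, θ 0 < θ 1 → θ 1 < -(θ 0 + θ 1) → -(θ 0 + θ 1) < θ 0 + 2 * π →
      JD (fun i => (Circle.exp ((![θ 0, θ 1, -(θ 0 + θ 1)] : Fin 3 → ℝ) i) : ℂ)) * ENNReal.ofReal
          ((∏ i, ∏ k ∈ Finset.univ.erase i,
            ‖(Circle.exp ((![θ 0, θ 1, -(θ 0 + θ 1)] : Fin 3 → ℝ) i) : ℂ) -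
              (Circle.exp ((![θ 0, θ 1, -(θ 0 + θ 1)] : Fin 3 → ℝ) k) : ℂ)‖) / (Fintype.card (Fin 3)).factorial) =
        JA θ * ENNReal.ofReal
          ((∏ i, ∏ k ∈ Finset.univ.erase i,
            ‖(Circle.exp ((![(G θ) 0, (G θ) 1, -((G θ) 0 + (G θ) 1)] : Fin 3 → ℝ) i) : ℂ) -
              (Circle.exp ((![(G θ) 0, (G θ) 1, -((G θ) 0 + (G θ) 1)] : Fin 3 → ℝ) k) : ℂ)‖) /
                (Fintype.card (Fin 3)).factorial))
    {J : Matrix.specialUnitaryGroup (Fin 3) ℂ → ℝ≥0∞}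
    (hJspec : ∀ (W : Matrix.specialUnitaryGroup (Fin 3) ℂ) (V : Matrix (Fin 3) (Fin 3) ℂ) (d : Fin 3 → ℂ),
      V ∈ Matrix.unitaryGroup (Fin 3) ℂ → (W : Matrix (Fin 3) (Fin 3) ℂ) = V * diagonal d * star V → J W = JD d) :
    HasJacobian (haarProbability (Matrix.specialUnitaryGroup (Fin 3) ℂ)) h J := by
  obtain ⟨fT, hfT⟩ := exists_torusMap_specialUnitary hf1 hfdet
  obtain ⟨Jf, hJfm, hJA, hJinv, hJ⟩ :=
    exists_torusDensity_su3_booked hE hP hfm hfperm hGA hfG hfT hJDm hJDperm hJchart hJspec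
  have hfJ : HasJacobian (haarProbability (specialDiagonalTorus (Fin 3))) fT Jf :=
    hasJacobian_su3Torus_of_alcoveMap hE hP hG (measurable_torusMap_of_measurable hfm hfT) hJfm
      (fun θ h0 h1 h2 => torusMap_angleChart_su3 hE hfT (hfG θ h0 h1 h2)) hJA
      (fun σ t => torusMap_permDiag (hP σ) (hfperm σ) hfT t) hJinv
  exact hasJacobian_spectralKernel_specialUnitaryGroup_of_measurable hfm hagree hfT hfJ
    (measurable_of_spectral hJDm hJspec) hJ

/-- **The `SU(3)` spectral coupling layer with the booked densities is an exact transport of product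
Haar.**  Links `ι`, mask `p`; per active link `a` and frozen context `y`: a staple `S a y` (continuous
in `y`); an eigenvalue map `f a y` (jointly measurable on context × unimodular torus, permutation
equivariant) given on the alcove by a map `G a y` sending `A` into `A` with
`HasJacobian (Leb|_A) (G a y) (JA a y)`; a kernel `h a y` following its recipe; and the BOOKED density `j a y ≥ 0` (jointly measurable in `(y, u)`), a symmetric function
`jD a y` (measurable) of the spectrum with
`jD a y(e^{ix(θ)}) · |Δ(e^{ix(θ)})|²/3! = JA a y(θ) · |Δ(e^{ix(G a y θ)})|²/3!` on `A`.  Then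
`Theory2.coupleFun p (u ↦ h a y (uS)(uS)⁻¹u)` has
`HasJacobian (⊗_ι Haar_{SU(3)}) _ (ofReal ∘ Theory2.coupleJac p (j at the loops))`. -/
theorem hasJacobian_spectralCouplingLayer_su3_booked {ι : Type*} [Fintype ι]
    (p : ι → Prop) [DecidablePred p]
    (S : {i // p i} → ({i // ¬p i} → Matrix.specialUnitaryGroup (Fin 3) ℂ) → Matrix.specialUnitaryGroup (Fin 3) ℂ)
    (hS : ∀ a, Continuous (S a))
    (f : {i // p i} → ({i // ¬p i} → Matrix.specialUnitaryGroup (Fin 3) ℂ) → (Fin 3 → ℂ) → (Fin 3 → ℂ))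
    (hfm : ∀ a, Measurable fun q : ({i // ¬p i} → Matrix.specialUnitaryGroup (Fin 3) ℂ) × (Fin 3 → ℂ) => f a q.1 q.2)
    (hfperm : ∀ a y (σ : Equiv.Perm (Fin 3)) (d : Fin 3 → ℂ), (∀ i, ‖d i‖ = 1) →
      f a y (fun i => d (σ i)) = fun i => f a y d (σ i))
    (G : {i // p i} → ({i // ¬p i} → Matrix.specialUnitaryGroup (Fin 3) ℂ) → (Fin 2 → ℝ) → (Fin 2 → ℝ))
    (JA : {i // p i} → ({i // ¬p i} → Matrix.specialUnitaryGroup (Fin 3) ℂ) → (Fin 2 → ℝ) → ℝ≥0∞)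
    (hG : ∀ a y, HasJacobian ((volume : Measure (Fin 2 → ℝ)).restrict
      {θ : Fin 2 → ℝ | θ 0 < θ 1 ∧ θ 1 < -(θ 0 + θ 1) ∧ -(θ 0 + θ 1) < θ 0 + 2 * π}) (G a y) (JA a y))
    (hGA : ∀ a y (θ : Fin 2 → ℝ), θ 0 < θ 1 → θ 1 < -(θ 0 + θ 1) → -(θ 0 + θ 1) < θ 0 + 2 * π →
      (G a y θ) 0 < (G a y θ) 1 ∧ (G a y θ) 1 < -((G a y θ) 0 + (G a y θ) 1) ∧
        -((G a y θ) 0 + (G a y θ) 1) < (G a y θ) 0 + 2 * π)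
    (hfG : ∀ a y (θ : Fin 2 → ℝ), θ 0 < θ 1 → θ 1 < -(θ 0 + θ 1) → -(θ 0 + θ 1) < θ 0 + 2 * π →
      f a y (fun i => (Circle.exp ((![θ 0, θ 1, -(θ 0 + θ 1)] : Fin 3 → ℝ) i) : ℂ)) =
        fun i => (Circle.exp ((![(G a y θ) 0, (G a y θ) 1, -((G a y θ) 0 + (G a y θ) 1)] : Fin 3 → ℝ) i) : ℂ))
    (h : {i // p i} → ({i // ¬p i} → Matrix.specialUnitaryGroup (Fin 3) ℂ) →
      Matrix.specialUnitaryGroup (Fin 3) ℂ → Matrix.specialUnitaryGroup (Fin 3) ℂ)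
    (hagree : ∀ a y (Q : Matrix.specialUnitaryGroup (Fin 3) ℂ) (V : Matrix (Fin 3) (Fin 3) ℂ) (d : Fin 3 → ℂ),
      V ∈ Matrix.unitaryGroup (Fin 3) ℂ → (Q : Matrix (Fin 3) (Fin 3) ℂ) = V * diagonal d * star V →
        ((h a y Q : Matrix.specialUnitaryGroup (Fin 3) ℂ) : Matrix (Fin 3) (Fin 3) ℂ) =
          V * diagonal (f a y d) * star V)
    (hf1 : ∀ a y (d : Fin 3 → ℂ), (∀ i, ‖d i‖ = 1) → ∀ i, ‖f a y d i‖ = 1)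
    (hfdet : ∀ a y (d : Fin 3 → ℂ), (∀ i, ‖d i‖ = 1) → ∏ i, d i = 1 → ∏ i, f a y d i = 1)
    (j : {i // p i} → ({i // ¬p i} → Matrix.specialUnitaryGroup (Fin 3) ℂ) →
      Matrix.specialUnitaryGroup (Fin 3) ℂ → ℝ)
    (hj0 : ∀ a y u, 0 ≤ j a y u)
    (jD : {i // p i} → ({i // ¬p i} → Matrix.specialUnitaryGroup (Fin 3) ℂ) → (Fin 3 → ℂ) → ℝ)
    (hjDm : ∀ a, Measurable fun q : ({i // ¬p i} → Matrix.specialUnitaryGroup (Fin 3) ℂ) × (Fin 3 → ℂ) => jD a q.1 q.2)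
    (hjDperm : ∀ a y (σ : Equiv.Perm (Fin 3)) (d : Fin 3 → ℂ), jD a y (fun i => d (σ i)) = jD a y d)
    (hjspec : ∀ a y (W : Matrix.specialUnitaryGroup (Fin 3) ℂ) (V : Matrix (Fin 3) (Fin 3) ℂ) (d : Fin 3 → ℂ),
      V ∈ Matrix.unitaryGroup (Fin 3) ℂ → (W : Matrix (Fin 3) (Fin 3) ℂ) = V * diagonal d * star V →
        j a y W = jD a y d)
    (hjchart : ∀ a y (θ : Fin 2 → ℝ), θ 0 < θ 1 → θ 1 < -(θ 0 + θ 1) → -(θ 0 + θ 1) < θ 0 + 2 * π →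
      ENNReal.ofReal (jD a y (fun i => (Circle.exp ((![θ 0, θ 1, -(θ 0 + θ 1)] : Fin 3 → ℝ) i) : ℂ))) *
          ENNReal.ofReal ((∏ i, ∏ k ∈ Finset.univ.erase i,
            ‖(Circle.exp ((![θ 0, θ 1, -(θ 0 + θ 1)] : Fin 3 → ℝ) i) : ℂ) -
              (Circle.exp ((![θ 0, θ 1, -(θ 0 + θ 1)] : Fin 3 → ℝ) k) : ℂ)‖) / (Fintype.card (Fin 3)).factorial) =
        JA a y θ * ENNReal.ofReal
          ((∏ i, ∏ k ∈ Finset.univ.erase i,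
            ‖(Circle.exp ((![(G a y θ) 0, (G a y θ) 1, -((G a y θ) 0 + (G a y θ) 1)] : Fin 3 → ℝ) i) : ℂ) -
              (Circle.exp ((![(G a y θ) 0, (G a y θ) 1, -((G a y θ) 0 + (G a y θ) 1)] : Fin 3 → ℝ) k) : ℂ)‖) /
                (Fintype.card (Fin 3)).factorial)) :
    HasJacobian (Measure.pi fun _ : ι => haarProbability (Matrix.specialUnitaryGroup (Fin 3) ℂ))
      (Theory2.coupleFun p fun a y u => h a y (u * S a y) * (u * S a y)⁻¹ * u)
      fun U => ENNReal.ofReal (Theory2.coupleJac p (fun a y u => j a y (u * S a y)) U) := by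
  -- each fibre's eigenvalue map is measurable (no continuity: the engine's `f` jumps across alcove walls)
  have hfslice : ∀ a y, Measurable (f a y) := fun a y => (hfm a).comp (measurable_const.prodMk measurable_id)
  have hjDslice : ∀ a y, Measurable (jD a y) := fun a y => (hjDm a).comp (measurable_const.prodMk measurable_id)
  -- the torus maps and the booked torus densities, link by link
  have hexT : ∀ a y, ∃ fT : specialDiagonalTorus (Fin 3) → specialDiagonalTorus (Fin 3), ∀ t : specialDiagonalTorus (Fin 3),
      ((fT t : Matrix.specialUnitaryGroup (Fin 3) ℂ) : Matrix (Fin 3) (Fin 3) ℂ) =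
        diagonal (f a y fun i => ((t : Matrix.specialUnitaryGroup (Fin 3) ℂ) : Matrix (Fin 3) (Fin 3) ℂ) i i) :=
    fun a y => exists_torusMap_specialUnitary (hf1 a y) (hfdet a y)
  choose fT hfT using hexT
  have hex : ∀ a y, ∃ Jf : specialDiagonalTorus (Fin 3) → ℝ≥0∞, Measurable Jf ∧
      (∀ θ : Fin 2 → ℝ, θ 0 < θ 1 → θ 1 < -(θ 0 + θ 1) → -(θ 0 + θ 1) < θ 0 + 2 * π → Jf (E θ) = JA a y θ) ∧
      (∀ σ t, Jf (P σ t) = Jf t) ∧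
      ∀ (g : Matrix.specialUnitaryGroup (Fin 3) ℂ) (t : specialDiagonalTorus (Fin 3)),
        ENNReal.ofReal (j a y (g * (t : Matrix.specialUnitaryGroup (Fin 3) ℂ) * g⁻¹)) * ENNReal.ofReal
            ((∏ i, ∏ k ∈ Finset.univ.erase i,
              ‖((t : Matrix.specialUnitaryGroup (Fin 3) ℂ) : Matrix (Fin 3) (Fin 3) ℂ) i i -
                ((t : Matrix.specialUnitaryGroup (Fin 3) ℂ) : Matrix (Fin 3) (Fin 3) ℂ) k k‖) / (Fintype.card (Fin 3)).factorial) =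
          Jf t * ENNReal.ofReal
            ((∏ i, ∏ k ∈ Finset.univ.erase i,
              ‖((fT a y t : Matrix.specialUnitaryGroup (Fin 3) ℂ) : Matrix (Fin 3) (Fin 3) ℂ) i i -
                ((fT a y t : Matrix.specialUnitaryGroup (Fin 3) ℂ) : Matrix (Fin 3) (Fin 3) ℂ) k k‖) /
                  (Fintype.card (Fin 3)).factorial) := by
    intro a y
    exact exists_torusDensity_su3_booked hE hP (hfslice a y) (hfperm a y) (hGA a y) (hfG a y) (hfT a y)
      (JD := fun d => ENNReal.ofReal (jD a y d)) (ENNReal.measurable_ofReal.comp (hjDslice a y))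
      (fun σ d => by simp only [hjDperm]) (hjchart a y)
      (J := fun W => ENNReal.ofReal (j a y W)) (fun W V d hV hW => by simp only [hjspec a y W V d hV hW])
  choose JfT hJfTm hJA hJinv hJ using hex
  have hfJ : ∀ a y, HasJacobian (haarProbability (specialDiagonalTorus (Fin 3))) (fT a y) (JfT a y) := by
    intro a y
    exact hasJacobian_su3Torus_of_alcoveMap hE hP (hG a y) (measurable_torusMap_of_measurable (hfslice a y) (hfT a y))
      (hJfTm a y) (fun θ h0 h1 h2 => torusMap_angleChart_su3 hE (hfT a y) (hfG a y θ h0 h1 h2)) (hJA a y)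
      (fun σ t => torusMap_permDiag (hP σ) (hfperm a y σ) (hfT a y) t) (hJinv a y)
  exact hasJacobian_spectralCouplingLayer_specialUnitary_of_measurable p S hS f hfm h hagree fT hfT JfT hfJ j hj0
    jD hjDm hjspec hJ

end SU3

end Summit.Ventures.LatticeQCDFlow.Exactness
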